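import Summits.HodgeConjecture.HodgeConjecture.Theorems.NikulinTwinTransportSectorComplement
import Summits.HodgeConjecture.HodgeConjecture.Theses.HolomorphicDefect
import Summits.HodgeConjecture.HodgeConjecture.Theses.QbarEnvelope
import Summits.HodgeConjecture.HodgeConjecture.Theses.AnchorTransport
import Summits.HodgeConjecture.HodgeConjecture.Theses.KuznetsovCYFactory
import Summits.HodgeConjecture.HodgeConjecture.Theses.IncidenceNodePeeling
import Summits.HodgeConjecture.HodgeConjecture.Theses.ConservativityLefschetz
import Literature.AlgebraicGeometry.HodgeTheory.ComplexConjugationHolds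
import Literature.Barriers.HodgeConjecture.DecompositionOfTheDiagonal

/-!
# Strategy census, gen 1 (seat s1) for `NikulinTwinTransport.SectorComplement` (stmt-HodgeConjecture-13684) — typed objects

Crux-strategist seat `planner-cstrat-stmt-HodgeConjecture-13684-s1-0`, 2026-08-17 (auto re-arm, reason
"route cone changed"). Companion of `Cruxes/SectorComplement/STRATEGY-CENSUS.md` (same seat, gen 1), which
SUPERSEDES the gen-0 census of seat `planner-cstrat-stmt-HodgeConjecture-13684-0` (@aea63ffcbe46) and keeps its
typed objects (`StrategyCensus13684.lean` @5d9ee991c7e2: degree split, André seam, strengthening law, ℚ̄-summit,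
negation shape) BY REFERENCE — nothing of that file is re-proved here.

What THIS file adds, kernel-checked over the tree's real declarations:

* §0 CONE INDEPENDENCE. The crux unfolds to `SquareHodgeOfSqrtTwo → _root_.HodgeConjecture` and nothing else
  (`crux_unfold`, `Iff.rfl`); the rev-14/15 cone change of the route (crux `K3PeriodSurjective`, stmt-15154, and
  two new imports) is INERT for this crux: adjoining any further hypothesis `K` to a line is the same as proving
  `K ∧ Σ → HC` (`adjoin_hypothesis_iff`).
* §1 LAW OF Σ-FREE SPLITS. A split `Sub₁ → Sub₂ → HC` of the SUMMIT is verbatim a split of the crux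
  (`cruxSplit_of_summitSplit₂/₃`), and every split of the crux is a split of the summit GIVEN Σ
  (`summitSplit_of_cruxSplit_given_sigma₂`). So "residual-free, non-reworded splits of the crux" = "summit routes".
* §2 CERTIFICATES that such residual-free splits EXIST in the tree and are other routes' deciding theorems, Σ unused:
  `sectorComplement_of_holomorphicDefect` (coniveau-one cut), `…_of_qbarEnvelope` (Voisin's ℚ̄ cut),
  `…_of_anchorTransport` / `…_of_kuznetsovCYFactory` (variational Hodge + anchors), `…_of_incidenceNodePeeling`
  (Thomas nodal / hypersurface cut), `…_of_conservativityLefschetz` (André seam + abelian complement) — the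
  `HodgeModels` binders discharged by the tree THEOREM `nonempty_hodgeModel_holds`.
* §3 TRANSFER T6 typed: the decomposition-of-the-diagonal engine (Bloch–Srinivas / Conte–Murre) as a dichotomy on
  the real carriers — where `CH₀` is supported in dimension ≤ 3 it proves the degree-4 slice, and a non-zero
  holomorphic `l`-form, `l ≥ 4`, forbids that hypothesis (`transfer_diagonal_dichotomy`, from the catalogued barrier
  `BlochSrinivas1983_hodgeTypeL0_vanish_of_chowZeroSupported` and the fact
  `BlochSrinivas1983_hodgeConjectureDegreeFour_of_chowZeroSupported`, both hypotheses, never asserted).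

Everything is sorry-free. Nothing here asserts a Theses decl or a named fact.
-/

set_option linter.dupNamespace false

namespace Summit.HodgeConjecture.HodgeConjecture.Cruxes.SectorComplement.StrategyCensusS1.NikulinTwinTransport

open Summit.HodgeConjecture.HodgeConjecture.Theses.NikulinTwinTransport
open Summit.HodgeConjecture.HodgeConjecture
open Literature.AlgebraicGeometry.HodgeTheory Literature.AlgebraicGeometry.Motives

/-! ## §0 Cone independence of the crux -/

/-- The crux is, by `rfl`, the implication "sector ⇒ summit"; its definitional cone is
`{SquareHodgeOfSqrtTwo, _root_.HodgeConjecture}` — no other route decl (in particular not the rev-14/15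
addition `K3PeriodSurjective`) occurs in it. [folklore] -/
theorem crux_unfold : SectorComplement ↔ (SquareHodgeOfSqrtTwo → _root_.HodgeConjecture) := Iff.rfl

/-- Adjoining ANY extra hypothesis `K` (e.g. the new crux `K3PeriodSurjective`, or any landed theorem) to a
line on the crux is the same as proving the summit from `K ∧ Σ`: the re-arm trigger cannot create leverage
unless `K ∧ Σ → HC` is easier than `Σ → HC`, i.e. unless `K` is itself summit-grade off the sector. [folklore] -/
theorem adjoin_hypothesis_iff (K : Prop) :
    (K → SectorComplement) ↔ (K ∧ SquareHodgeOfSqrtTwo → _root_.HodgeConjecture) :=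
  ⟨fun h hk ↦ h hk.1 hk.2, fun h k s ↦ h ⟨k, s⟩⟩

/-- Instance: the rev-14/15 crux `K3PeriodSurjective` (stmt-15154) adjoined. [folklore] -/
theorem adjoin_k3PeriodSurjective_iff :
    (K3PeriodSurjective → SectorComplement) ↔
      (K3PeriodSurjective ∧ SquareHodgeOfSqrtTwo → _root_.HodgeConjecture) :=
  adjoin_hypothesis_iff K3PeriodSurjective

/-! ## §1 The law of Σ-free splits -/

/-- A 2-piece split of the SUMMIT is verbatim a 2-piece split of the crux (Σ discarded). [folklore] -/
theorem cruxSplit_of_summitSplit₂ {S₁ S₂ : Prop} (h : S₁ → S₂ → _root_.HodgeConjecture) :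
    S₁ → S₂ → SectorComplement :=
  fun a b _ ↦ h a b

/-- A 3-piece split of the SUMMIT is verbatim a 3-piece split of the crux (Σ discarded). [folklore] -/
theorem cruxSplit_of_summitSplit₃ {S₁ S₂ S₃ : Prop} (h : S₁ → S₂ → S₃ → _root_.HodgeConjecture) :
    S₁ → S₂ → S₃ → SectorComplement :=
  fun a b c _ ↦ h a b c

/-- Conversely every 2-piece split of the crux is a split of the summit GIVEN the sector: the pieces of any
split prove `Σ → HC`, so a split whose pieces do not mention Σ is a split of `HC` restricted to nothing —
a summit thesis (law of lines, p84060 / triage W.lean, in split form). [folklore] -/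
theorem summitSplit_of_cruxSplit_given_sigma₂ {S₁ S₂ : Prop} (h : S₁ → S₂ → SectorComplement) :
    S₁ → S₂ → SquareHodgeOfSqrtTwo → _root_.HodgeConjecture :=
  fun a b s ↦ h a b s

/-- And with the landed truth table: a split of the crux whose pieces hold settles the summit's truth value
relative to Σ — `HC ↔ Σ` (cites p84060 `nikulinTwinTransport_hodgeConjecture_iff_sector_and_complement`). -/
theorem hodgeConjecture_iff_sigma_of_cruxSplit₂ {S₁ S₂ : Prop} (h : S₁ → S₂ → SectorComplement)
    (a : S₁) (b : S₂) : _root_.HodgeConjecture ↔ SquareHodgeOfSqrtTwo :=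
  ⟨Theorems.nikulinTwinTransport_squareHodgeOfSqrtTwo_of_hodgeConjecture, fun s ↦ h a b s⟩

/-! ## §2 Residual-free splits of the crux that EXIST in the tree: other routes' deciding theorems -/

/-- D5 (coniveau-one cut, route HolomorphicDefect): `SupportedHodgeClassDescent → HodgeClassesConiveauOne →
SectorComplement`, Σ unused, Hodge models discharged by the tree theorem `nonempty_hodgeModel_holds`. -/
theorem sectorComplement_of_holomorphicDefect
    (hD : Theses.HolomorphicDefect.SupportedHodgeClassDescent)
    (hC : Theses.HolomorphicDefect.HodgeClassesConiveauOne) : SectorComplement :=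
  fun _ ↦ Theses.HolomorphicDefect.closes (fun _ _ hX ↦ nonempty_hodgeModel_holds hX) hD hC

/-- D6 (Voisin's ℚ̄ cut, route QbarEnvelope): `Envelope → HCOverNumberFields → PullbackAlgebraic →
SectorComplement`, Σ unused. -/
theorem sectorComplement_of_qbarEnvelope
    (hE : Theses.QbarEnvelope.Envelope) (hC : Theses.QbarEnvelope.HCOverNumberFields)
    (hP : Theses.QbarEnvelope.PullbackAlgebraic) : SectorComplement :=
  fun _ ↦ Theses.QbarEnvelope.closes hE hC hP (fun _ _ ↦ nonempty_hodgeModel_holds)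

/-- D7 (variational Hodge + anchors, route AnchorTransport): `VariationalHodge → AnchorExistence →
IsoInvariance → SectorComplement`, Σ unused. -/
theorem sectorComplement_of_anchorTransport
    (hV : Theses.AnchorTransport.VariationalHodge) (hA : Theses.AnchorTransport.AnchorExistence)
    (hI : Theses.AnchorTransport.IsoInvariance) : SectorComplement :=
  fun _ ↦ Theses.AnchorTransport.closes hV hA hI (fun _ _ ↦ nonempty_hodgeModel_holds)

/-- D7' (same frame pair, route KuznetsovCYFactory): `VariationalHodgeSmooth → AnchorExistence →
SectorComplement`, Σ unused. -/
theorem sectorComplement_of_kuznetsovCYFactory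
    (hV : Theses.KuznetsovCYFactory.VariationalHodgeSmooth)
    (hA : Theses.KuznetsovCYFactory.AnchorExistence) : SectorComplement :=
  fun _ ↦ Theses.KuznetsovCYFactory.closes hV hA (fun _ _ ↦ nonempty_hodgeModel_holds)

/-- D8 (Thomas-nodal / hypersurface cut, route IncidenceNodePeeling): `HCMovablePairs → HCRigidPairs →
HypersurfaceMiddleReduction → HCNonHypersurfaces → SectorComplement`, Σ unused. -/
theorem sectorComplement_of_incidenceNodePeeling
    (h₁ : Theses.IncidenceNodePeeling.HCMovablePairs) (h₂ : Theses.IncidenceNodePeeling.HCRigidPairs)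
    (h₄ : Theses.IncidenceNodePeeling.HypersurfaceMiddleReduction)
    (h₅ : Theses.IncidenceNodePeeling.HCNonHypersurfaces) : SectorComplement :=
  fun _ ↦ Theses.IncidenceNodePeeling.closes h₁ h₂ (fun _ _ ↦ nonempty_hodgeModel_holds) h₄ h₅

/-- D2 revisited (André seam + abelian complement frame, route ConservativityLefschetz):
`AbelianPencilLefschetzB → AndreAbelianReduction → ClassicalBettiDatum → AbelianComplement → SectorComplement`,
Σ unused — one route's complement frame composed into another's. -/
theorem sectorComplement_of_conservativityLefschetz
    (h₁ : Theses.ConservativityLefschetz.AbelianPencilLefschetzB)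
    (h₂ : Theses.ConservativityLefschetz.AndreAbelianReduction)
    (h₃ : Theses.ConservativityLefschetz.ClassicalBettiDatum)
    (h₄ : Theses.ConservativityLefschetz.AbelianComplement) : SectorComplement :=
  fun _ ↦ Theses.ConservativityLefschetz.closes h₁ h₂ h₃ h₄

/-! ## §3 Transfer T6: the decomposition-of-the-diagonal engine, typed as a dichotomy on real carriers -/

/-- **Where the Bloch–Srinivas / Conte–Murre engine bites and where it is forbidden**, for one smooth
projective `X` of dimension `n`: (a) if `CH₀(X)` is supported on a closed subset of dimension `≤ 3`, every
rational `(2,2)`-class of degree 4 on `X` is algebraic (the engine, Voisin II Prop. 10.26, tree fact as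
hypothesis); (b) a single non-zero class of type `(l,0)` with `l ≥ 4` (a holomorphic `l`-form) rules the
hypothesis out (the catalogued barrier, Voisin II Thm. 10.4/10.17, Mumford–Roitman–Bloch–Srinivas). The
complement's hard core (`h^{l,0} ≠ 0`, e.g. the very general hypersurface of degree `≥ n + 2` in `ℙⁿ⁺¹`,
`n ≥ 4`) is case (b). [cite: VoisinHodgeII2003, Prop. 10.26 and Thm. 10.17] [cite: BlochSrinivas1983]
[cite: ConteMurre1978] -/
theorem transfer_diagonal_dichotomy
    (hBar : Literature.Barriers.HodgeConjecture.BlochSrinivas1983_hodgeTypeL0_vanish_of_chowZeroSupported)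
    (hEng : Literature.Barriers.HodgeConjecture.BlochSrinivas1983_hodgeConjectureDegreeFour_of_chowZeroSupported)
    {n : ℕ} {X : SchemeOver ℂ} (hX : IsSmoothProjective n X) :
    (Literature.Barriers.HodgeConjecture.HasChowZeroSupportedInDimLE X 3 →
        ∀ c : Literature.AlgebraicTopology.SingularHomology.singularCohomology ℂ ℂ (ComplexPoints X) (2 * 2),
          IsRationalClass c → IsOfHodgeType n X (2 * 2) 2 2 c → c ∈ algebraicClasses X 2) ∧
      (∀ ⦃l : ℕ⦄ (c : Literature.AlgebraicTopology.SingularHomology.singularCohomology ℂ ℂ (ComplexPoints X) l),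
          3 < l → IsOfHodgeType n X l l 0 c → c ≠ 0 →
            ¬ Literature.Barriers.HodgeConjecture.HasChowZeroSupportedInDimLE X 3) :=
  ⟨fun hW c hc h22 ↦ hEng hX hW c hc h22,
    fun _ _ hl hc hc0 ↦
      Literature.Barriers.HodgeConjecture.not_hasChowZeroSupportedInDimLE_of_isOfHodgeType hBar hX hl hc hc0⟩

/-- The engine never leaves degree 4: as a line on the crux it would have to be adjoined as the hypothesis
"`CH₀` of EVERY smooth projective variety is supported in dimension ≤ 3", which case (b) refutes on any
variety with a non-zero holomorphic 4-form — so the adjoined-hypothesis form `K ∧ Σ → HC` of §0 is vacuous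
there, not a proof. Recorded as the typed reason T6 gives no leverage. [cite: VoisinHodgeII2003, Thm. 10.17] -/
theorem transfer_diagonal_no_global_hypothesis
    (hBar : Literature.Barriers.HodgeConjecture.BlochSrinivas1983_hodgeTypeL0_vanish_of_chowZeroSupported)
    {n : ℕ} {X : SchemeOver ℂ} (hX : IsSmoothProjective n X)
    {c : Literature.AlgebraicTopology.SingularHomology.singularCohomology ℂ ℂ (ComplexPoints X) 4}
    (hc : IsOfHodgeType n X 4 4 0 c) (hc0 : c ≠ 0) :
    ¬ (∀ (m : ℕ) (Y : SchemeOver ℂ), IsSmoothProjective m Y →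
        Literature.Barriers.HodgeConjecture.HasChowZeroSupportedInDimLE Y 3) :=
  fun hAll ↦
    Literature.Barriers.HodgeConjecture.not_hasChowZeroSupportedInDimLE_of_isOfHodgeType hBar hX
      (by norm_num) hc hc0 (hAll n X hX)

end Summit.HodgeConjecture.HodgeConjecture.Cruxes.SectorComplement.StrategyCensusS1.NikulinTwinTransport
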